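import Mathlib.Analysis.SpecialFunctions.Pow.Real
import HarnessLib

/-!
# QUANT lane R8, T-DEC: every finitely supported law on `ℕ` is a mixture of TWO-POINT laws with the SAME MEAN (r4 of DEC-TAMP-G50)

builds on p205010 (kernel theorem, internal audit signed; external expert review pending)

Support file (`--supports stmt-CriticalPhenomena-4575`), QUANT lane seat prim-quant-census-2 (gen 50); memo
`run/shared/lean/prim/quant/prim-quant-census-2-g50/DEC-TAMP-G50.md` §1 (r4) and Lemma P.  This is the 'mean-preserving re-pairing'
used by Theorem A (TA-MP): a nonnegative `p : ℕ → ℝ` supported in a finset `S` with first moment `T·(mass)` is a finite nonnegative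
combination of two-point laws `TP[lo, hi, g] = g·δ_hi + (1−g)·δ_lo` with `lo ≤ hi` both in `S` and mean `(1−g)·lo + g·hi = T`
(point masses `lo = hi = T` included), the weights summing to the mass of `p`.  With the typer's `RootDec` notation this is the
existence of the mixture data `(λ, lo, hi, g)` for one structure law; Lemma P of the memo (closure of top-affordable mean-exact
decompositions under independent sums) is this theorem applied to each product of two components, since every atom of the product
is at most the sum of the tops.  Proof: greedy pairing of an atom below `T` with an atom above `T` at the mean-`T` gate, exhausting one
of them; induction on the support.  Theorems only; no sorries; standard axioms.  [this work]
-/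

namespace Summit.CriticalPhenomena.PercolationContinuityZ3.Theorems

namespace Quant

namespace TAMP

open Finset

/-- the two-point law `{lo, hi; g}` evaluated at `h` (same shape as `RootDec`'s `TP[lo, hi, g, h]`) -/
local notation3 "TP[" lo ", " hi ", " g ", " h "]" =>
  (g : ℝ) * (if (h : ℕ) = (hi : ℕ) then (1 : ℝ) else 0) + (1 - (g : ℝ)) * (if (h : ℕ) = (lo : ℕ) then (1 : ℝ) else 0)

/-- **Mean-preserving two-point decomposition (r4).**  A nonnegative `p` supported in `S` whose first moment is `T` times its mass is a
nonnegative combination of two-point laws with atoms in `S`, `lo ≤ hi`, gates in `[0,1]` and mean exactly `T`, with total weight the mass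
of `p`. [this work] -/
theorem exists_twoPoint_mixture_mean (S : Finset ℕ) :
    ∀ (p : ℕ → ℝ) (T : ℝ), (∀ k, 0 ≤ p k) → (∀ k, k ∉ S → p k = 0) →
      (∑ k ∈ S, p k * (k : ℝ) = T * ∑ k ∈ S, p k) →
      ∃ (n : ℕ) (lo hi : Fin n → ℕ) (g w : Fin n → ℝ),
        (∀ i, lo i ∈ S ∧ hi i ∈ S ∧ lo i ≤ hi i ∧ 0 ≤ g i ∧ g i ≤ 1 ∧ 0 ≤ w i ∧
              (1 - g i) * (lo i : ℝ) + g i * (hi i : ℝ) = T) ∧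
        (∑ i, w i = ∑ k ∈ S, p k) ∧
        (∀ h : ℕ, p h = ∑ i, w i * TP[lo i, hi i, g i, h]) := by
  induction S using Finset.strongInduction with
  | H S ih =>
  intro p T hp0 hpS hmean
  -- Case A: p vanishes on S (hence everywhere): the empty mixture
  by_cases hA : ∀ k ∈ S, p k = 0
  · refine ⟨0, Fin.elim0, Fin.elim0, Fin.elim0, Fin.elim0, fun i => i.elim0, ?_, ?_⟩
    · simp only [univ_eq_empty, sum_empty]
      exact (sum_eq_zero hA).symm
    · intro h
      simp only [univ_eq_empty, sum_empty]
      by_cases hh : h ∈ S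
      · exact hA h hh
      · exact hpS h hh
  push Not at hA
  obtain ⟨k₁, hk₁S, hk₁⟩ := hA
  have hk₁pos : 0 < p k₁ := lt_of_le_of_ne (hp0 k₁) (Ne.symm hk₁)
  have hmass : 0 < ∑ k ∈ S, p k := lt_of_lt_of_le hk₁pos (single_le_sum (fun k _ => hp0 k) hk₁S)
  -- Case B1: every atom with positive mass sits at T: one point mass
  by_cases hB : ∀ k ∈ S, 0 < p k → (k : ℝ) = T
  · have hT : (k₁ : ℝ) = T := hB k₁ hk₁S hk₁pos
    -- all positive mass is at the single natural number k₁
    have hsame : ∀ k ∈ S, k ≠ k₁ → p k = 0 := by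
      intro k hk hne
      by_contra hne0
      have hpos : 0 < p k := lt_of_le_of_ne (hp0 k) (Ne.symm hne0)
      have := hB k hk hpos
      apply hne; exact_mod_cast (this.trans hT.symm)
    have hsum : ∑ k ∈ S, p k = p k₁ := by
      rw [← Finset.sum_erase_add S _ hk₁S]
      have : ∑ k ∈ S.erase k₁, p k = 0 :=
        sum_eq_zero (fun k hk => hsame k (mem_of_mem_erase hk) (ne_of_mem_erase hk))
      rw [this, zero_add]
    refine ⟨1, fun _ => k₁, fun _ => k₁, fun _ => 0, fun _ => p k₁, ?_, ?_, ?_⟩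
    · intro i
      refine ⟨hk₁S, hk₁S, le_rfl, le_rfl, zero_le_one, hp0 k₁, ?_⟩
      rw [← hT]; ring
    · simp [hsum]
    · intro h
      simp only [univ_unique, Fin.default_eq_zero, sum_singleton, zero_mul, sub_zero, one_mul, zero_add]
      by_cases hh : h = k₁
      · subst hh; simp
      · simp only [hh, if_false, mul_zero]
        by_cases hhS : h ∈ S
        · exact hsame h hhS hh
        · exact hpS h hhS
  -- Case B2: some positive-mass atom is off T; then there are positive-mass atoms strictly below and strictly above T
  push Not at hB
  obtain ⟨k₂, hk₂S, hk₂pos, hk₂T⟩ := hB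
  have hbelow : ∃ lo ∈ S, 0 < p lo ∧ (lo : ℝ) < T := by
    by_contra hno
    push Not at hno
    -- all positive-mass atoms are ≥ T, and k₂ is > T: first moment too large
    have hge : ∀ k ∈ S, p k * T ≤ p k * (k : ℝ) := by
      intro k hk
      by_cases hpk : 0 < p k
      · exact mul_le_mul_of_nonneg_left (hno k hk hpk) (hp0 k)
      · have : p k = 0 := le_antisymm (not_lt.mp hpk) (hp0 k)
        simp [this]
    have hgt : p k₂ * T < p k₂ * (k₂ : ℝ) :=
      mul_lt_mul_of_pos_left (lt_of_le_of_ne (hno k₂ hk₂S hk₂pos) (Ne.symm hk₂T)) hk₂pos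
    have : ∑ k ∈ S, p k * T < ∑ k ∈ S, p k * (k : ℝ) := sum_lt_sum hge ⟨k₂, hk₂S, hgt⟩
    rw [hmean, ← sum_mul] at this
    linarith [mul_comm T (∑ k ∈ S, p k)]
  have habove : ∃ hi ∈ S, 0 < p hi ∧ T < (hi : ℝ) := by
    by_contra hno
    push Not at hno
    have hle : ∀ k ∈ S, p k * (k : ℝ) ≤ p k * T := by
      intro k hk
      by_cases hpk : 0 < p k
      · exact mul_le_mul_of_nonneg_left (hno k hk hpk) (hp0 k)
      · have : p k = 0 := le_antisymm (not_lt.mp hpk) (hp0 k)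
        simp [this]
    obtain ⟨lo, hloS, hlopos, hloT⟩ := hbelow
    have hlt : p lo * (lo : ℝ) < p lo * T := mul_lt_mul_of_pos_left hloT hlopos
    have : ∑ k ∈ S, p k * (k : ℝ) < ∑ k ∈ S, p k * T := sum_lt_sum hle ⟨lo, hloS, hlt⟩
    rw [hmean, ← sum_mul] at this
    linarith [mul_comm T (∑ k ∈ S, p k)]
  obtain ⟨lo, hloS, hlopos, hloT⟩ := hbelow
  obtain ⟨hi, hhiS, hhipos, hhiT⟩ := habove
  have hlohi : (lo : ℝ) < hi := hloT.trans hhiT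
  have hlohiN : lo < hi := by exact_mod_cast hlohi
  have hne : lo ≠ hi := ne_of_lt hlohiN
  -- the mean-T gate and the weight exhausting one of the two atoms
  set g : ℝ := (T - lo) / (hi - lo) with hg
  have hd : 0 < (hi : ℝ) - lo := by linarith
  have hg0 : 0 < g := div_pos (by linarith) hd
  have hg1 : g < 1 := by rw [hg, div_lt_one hd]; linarith
  have hmeanTP : (1 - g) * (lo : ℝ) + g * hi = T := by
    rw [hg]; field_simp; ring
  set w : ℝ := min (p lo / (1 - g)) (p hi / g) with hw
  have hw0 : 0 ≤ w := le_min (div_nonneg (hp0 lo) (by linarith)) (div_nonneg (hp0 hi) hg0.le)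
  have hwlo : w * (1 - g) ≤ p lo := by
    have : w ≤ p lo / (1 - g) := min_le_left _ _
    rwa [le_div_iff₀ (by linarith)] at this
  have hwhi : w * g ≤ p hi := by
    have : w ≤ p hi / g := min_le_right _ _
    rwa [le_div_iff₀ hg0] at this
  -- the residual law
  set p' : ℕ → ℝ := fun h => p h - w * TP[lo, hi, g, h] with hp'
  have hp'def : ∀ h, p' h = p h - w * TP[lo, hi, g, h] := fun h => rfl
  have hTPlo : TP[lo, hi, g, lo] = 1 - g := by simp [hne]
  have hTPhi : TP[lo, hi, g, hi] = g := by simp [hne.symm]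
  have hTPoff : ∀ h, h ≠ lo → h ≠ hi → TP[lo, hi, g, h] = 0 := by
    intro h h1 h2; simp [h1, h2]
  have hp'lo : p' lo = p lo - w * (1 - g) := by rw [hp'def, hTPlo]
  have hp'hi : p' hi = p hi - w * g := by rw [hp'def, hTPhi]
  have hp'off : ∀ h, h ≠ lo → h ≠ hi → p' h = p h := by
    intro h h1 h2; rw [hp'def, hTPoff h h1 h2, mul_zero, sub_zero]
  have hp'0 : ∀ k, 0 ≤ p' k := by
    intro k
    by_cases h1 : k = lo
    · rw [h1, hp'lo]; linarith
    by_cases h2 : k = hi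
    · rw [h2, hp'hi]; linarith
    rw [hp'off k h1 h2]; exact hp0 k
  -- which atom is exhausted
  have hex : p' lo = 0 ∨ p' hi = 0 := by
    rcases le_total (p lo / (1 - g)) (p hi / g) with hle | hle
    · left
      have : w = p lo / (1 - g) := by rw [hw, min_eq_left hle]
      have h1g : (1 - g) ≠ 0 := ne_of_gt (by linarith)
      rw [hp'lo, this, div_mul_cancel₀ (p lo) h1g, sub_self]
    · right
      have : w = p hi / g := by rw [hw, min_eq_right hle]
      rw [hp'hi, this, div_mul_cancel₀ (p hi) (ne_of_gt hg0), sub_self]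
  -- the exhausted atom k₀ and the smaller support
  obtain ⟨k₀, hk₀S, hk₀⟩ : ∃ k₀ ∈ S, p' k₀ = 0 ∧ (k₀ = lo ∨ k₀ = hi) := by
    rcases hex with h | h
    · exact ⟨lo, hloS, h, Or.inl rfl⟩
    · exact ⟨hi, hhiS, h, Or.inr rfl⟩
  set S' := S.erase k₀ with hS'
  have hS'sub : S' ⊂ S := erase_ssubset hk₀S
  have hp'S' : ∀ k, k ∉ S' → p' k = 0 := by
    intro k hk
    by_cases hkk : k = k₀
    · rw [hkk]; exact hk₀.1
    · have hkS : k ∉ S := fun hkS => hk (mem_erase.mpr ⟨hkk, hkS⟩)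
      have h1 : k ≠ lo := fun h => hkS (h ▸ hloS)
      have h2 : k ≠ hi := fun h => hkS (h ▸ hhiS)
      rw [hp'off k h1 h2]; exact hpS k hkS
  -- sums of p' over S: mass and first moment
  have hTPsum : ∑ k ∈ S, TP[lo, hi, g, k] = 1 := by
    rw [← Finset.sum_erase_add S _ hloS, hTPlo]
    rw [← Finset.sum_erase_add (S.erase lo) _ (mem_erase.mpr ⟨hne.symm, hhiS⟩), hTPhi]
    have : ∑ x ∈ (S.erase lo).erase hi, TP[lo, hi, g, x] = 0 := by
      apply sum_eq_zero; intro k hk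
      have h2 : k ≠ hi := ne_of_mem_erase hk
      have h1 : k ≠ lo := ne_of_mem_erase (mem_of_mem_erase hk)
      exact hTPoff k h1 h2
    rw [this]; ring
  have hTPmom : ∑ k ∈ S, TP[lo, hi, g, k] * (k : ℝ) = T := by
    rw [← Finset.sum_erase_add S _ hloS, hTPlo]
    rw [← Finset.sum_erase_add (S.erase lo) _ (mem_erase.mpr ⟨hne.symm, hhiS⟩), hTPhi]
    have : ∑ x ∈ (S.erase lo).erase hi, TP[lo, hi, g, x] * (x : ℝ) = 0 := by
      apply sum_eq_zero; intro k hk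
      have h2 : k ≠ hi := ne_of_mem_erase hk
      have h1 : k ≠ lo := ne_of_mem_erase (mem_of_mem_erase hk)
      rw [hTPoff k h1 h2, zero_mul]
    rw [this, ← hmeanTP]; ring
  have hmass' : ∑ k ∈ S, p' k = ∑ k ∈ S, p k - w := by
    have : ∑ k ∈ S, p' k = ∑ k ∈ S, (p k - w * TP[lo, hi, g, k]) := sum_congr rfl (fun k _ => hp'def k)
    rw [this, sum_sub_distrib, ← mul_sum, hTPsum, mul_one]
  have hmom' : ∑ k ∈ S, p' k * (k : ℝ) = T * ∑ k ∈ S, p' k := by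
    have : ∑ k ∈ S, p' k * (k : ℝ) = ∑ k ∈ S, (p k * (k : ℝ) - w * (TP[lo, hi, g, k] * (k : ℝ))) :=
      sum_congr rfl (fun k _ => by rw [hp'def]; ring)
    rw [this, sum_sub_distrib, ← mul_sum, hTPmom, hmass', hmean]; ring
  -- restrict the sums to S' (p' vanishes at k₀)
  have hsumS' : ∀ f : ℕ → ℝ, ∑ k ∈ S, p' k * f k = ∑ k ∈ S', p' k * f k := by
    intro f
    rw [hS', ← Finset.sum_erase_add S _ hk₀S, hk₀.1, zero_mul, add_zero]
  have hmassS' : ∑ k ∈ S', p' k = ∑ k ∈ S, p k - w := by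
    have := hsumS' (fun _ => 1); simp only [mul_one] at this; rw [← this, hmass']
  have hmomS' : ∑ k ∈ S', p' k * (k : ℝ) = T * ∑ k ∈ S', p' k := by
    have h1 := hsumS' (fun k => (k : ℝ)); have h2 := hsumS' (fun _ => 1)
    simp only [mul_one] at h2
    rw [← h1, ← h2]; exact hmom'
  -- induction hypothesis on S'
  obtain ⟨n, lo', hi', g', w', hcomp, hwsum, hrep⟩ := ih S' hS'sub p' T hp'0 hp'S' hmomS'
  refine ⟨n + 1, Fin.cons lo lo', Fin.cons hi hi', Fin.cons g g', Fin.cons w w', ?_, ?_, ?_⟩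
  · intro i
    refine Fin.cases ?_ ?_ i
    · simp only [Fin.cons_zero]
      exact ⟨hloS, hhiS, hlohiN.le, hg0.le, hg1.le, hw0, hmeanTP⟩
    · intro i'
      simp only [Fin.cons_succ]
      obtain ⟨h1, h2, h3, h4, h5, h6, h7⟩ := hcomp i'
      exact ⟨(mem_of_mem_erase h1), (mem_of_mem_erase h2), h3, h4, h5, h6, h7⟩
  · rw [Fin.sum_univ_succ]; simp only [Fin.cons_zero, Fin.cons_succ]
    rw [hwsum, hmassS']; ring
  · intro h
    rw [Fin.sum_univ_succ]; simp only [Fin.cons_zero, Fin.cons_succ]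
    rw [← hrep h, hp'def]; ring

/-- **Top-affordable version (Lemma P of the memo in law form).**  If moreover every atom of the support is affordable at floor `y`
for the target `T` (`y·k ≤ T` for `k ∈ S` — e.g. the support of a product of two top-affordable components, whose atoms are at most the
sum of the tops), then the mean-`T` two-point decomposition is TOP-AFFORDABLE: `y·hi ≤ T` for every component. [this work] -/
theorem exists_twoPoint_mixture_mean_top (S : Finset ℕ) (p : ℕ → ℝ) (T y : ℝ)
    (hp0 : ∀ k, 0 ≤ p k) (hpS : ∀ k, k ∉ S → p k = 0)
    (hmean : ∑ k ∈ S, p k * (k : ℝ) = T * ∑ k ∈ S, p k) (htop : ∀ k ∈ S, y * (k : ℝ) ≤ T) :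
    ∃ (n : ℕ) (lo hi : Fin n → ℕ) (g w : Fin n → ℝ),
      (∀ i, lo i ∈ S ∧ hi i ∈ S ∧ lo i ≤ hi i ∧ 0 ≤ g i ∧ g i ≤ 1 ∧ 0 ≤ w i ∧
            (1 - g i) * (lo i : ℝ) + g i * (hi i : ℝ) = T ∧ y * (hi i : ℝ) ≤ T) ∧
      (∑ i, w i = ∑ k ∈ S, p k) ∧
      (∀ h : ℕ, p h = ∑ i, w i * TP[lo i, hi i, g i, h]) := by
  obtain ⟨n, lo, hi, g, w, hcomp, hsum, hrep⟩ := exists_twoPoint_mixture_mean S p T hp0 hpS hmean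
  refine ⟨n, lo, hi, g, w, fun i => ?_, hsum, hrep⟩
  obtain ⟨h1, h2, h3, h4, h5, h6, h7⟩ := hcomp i
  exact ⟨h1, h2, h3, h4, h5, h6, h7, htop _ h2⟩

end TAMP

end Quant

end Summit.CriticalPhenomena.PercolationContinuityZ3.Theorems
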